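import Mathlib

/-!
# Window determinant trick (stub `stub_windowDeterminantTrick`)

Crux item stmt-Langlands-8485, route `CapacityClassicality`, line `Sketch-ideate-r1-k1`, stub S14
`stub_windowDeterminantTrick`: the "adjugate trick" behind the sup-norm Sturm principle of the
line's engine.

Let `R` be a commutative ring, `𝔪` a maximal ideal of `R`, `A : δ → X → R` a family of
coefficients with finitely many rows `j : δ` and a finite window `W : Finset X` of columns.  If the
rows of the window matrix `(A j x)_{j, x ∈ W}` are linearly independent modulo `𝔪` (hypothesis
`hA`: `∑_j y_j A j x ∈ 𝔪` for all `x ∈ W` forces all `y_j ∈ 𝔪`), then for every further column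
`m : X` there are `D ∉ 𝔪` and `k : X → R` supported on `W` with
`D · A j m = ∑_{x ∈ W} k x · A j x` for every `j`.

## Proof

Reduce the window matrix `A'` modulo `𝔪` into the residue field `R ⧸ 𝔪`; `hA` says that
`v ↦ v ᵥ* A'̄` is injective on `(R ⧸ 𝔪)^δ`, so `A'̄` has a right inverse `C̄`.  Lift `C̄`
entrywise to `C₀` over `R`; then `A' C₀ ≡ 1 (mod 𝔪)`, so `D := det (A' C₀) ≡ 1 (mod 𝔪)`, hence
`D ∉ 𝔪`, and with `C := C₀ · adj (A' C₀)` one has `A' C = D · 1`.  Applying this to the column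
`a = (A j m)_j` gives `D a = A' (C a)`, and `k := C a` (extended by zero off `W`) works.

This is the generalisation from `(ℤ, p)` to `(R, 𝔪)` of the adjugate trick used for the sibling
stub `stub_supNormOfSturm` (crux stmt-Langlands-8457).  Only Mathlib is used.
-/

open scoped Matrix

set_option linter.dupNamespace false -- project-wide option (lakefile weak.linter.dupNamespace); `Summit.Langlands.Langlands` is the mandated namespace

namespace Summit.Langlands.Langlands.Theorems.HilbertIntegralOverconvergentIsCongruence

/-- **Adjugate trick over a residue field.** A matrix `A` over a commutative ring `R` whose rows
are linearly independent modulo the maximal ideal `𝔪` (if all entries of `y ᵥ* A` lie in `𝔪`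
then all `y j ∈ 𝔪`) admits a matrix `C` over `R` with `A * C = D • 1` and `D ∉ 𝔪`: lift a right
inverse of `A mod 𝔪` to a matrix `C₀` over `R`, so that `A C₀ ≡ 1 (mod 𝔪)`, and put
`C = C₀ adj(A C₀)`, `D = det (A C₀)`. [folklore] -/
private theorem winDet_exists_mul_eq_smul_one {R : Type*} [CommRing R] (𝔪 : Ideal R)
    [𝔪.IsMaximal] {δ ν : Type*} [Fintype δ] [DecidableEq δ] [Fintype ν] (A : Matrix δ ν R)
    (hA : ∀ y : δ → R, (∀ i, (y ᵥ* A) i ∈ 𝔪) → ∀ j, y j ∈ 𝔪) :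
    ∃ (D : R) (C : Matrix ν δ R), D ∉ 𝔪 ∧ A * C = D • (1 : Matrix δ δ R) := by
  classical
  letI := Ideal.Quotient.field 𝔪
  -- the reduction of `A` modulo `𝔪`
  obtain ⟨Ab, hAb⟩ :
      ∃ Ab : Matrix δ ν (R ⧸ 𝔪), Ab = A.map (Ideal.Quotient.mk 𝔪) := ⟨_, rfl⟩
  -- a set-theoretic section of the reduction map
  obtain ⟨s, hs⟩ : ∃ s : R ⧸ 𝔪 → R, ∀ q, Ideal.Quotient.mk 𝔪 (s q) = q :=
    ⟨_, Function.surjInv_eq (Ideal.Quotient.mk_surjective (I := 𝔪))⟩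
  -- the rows of `A mod 𝔪` are linearly independent: `v ↦ Abᵀ v` is injective
  have hker : LinearMap.ker (Matrix.toLin' Abᵀ) = ⊥ := by
    rw [LinearMap.ker_eq_bot']
    intro v hv
    rw [Matrix.toLin'_apply, Matrix.mulVec_transpose] at hv
    have hv' : ∀ i, ((fun j ↦ s (v j)) ᵥ* A) i ∈ 𝔪 := by
      intro i
      have hcomp : (Ideal.Quotient.mk 𝔪) ∘ (fun j ↦ s (v j)) = v := funext fun j ↦ hs (v j)
      rw [← Ideal.Quotient.eq_zero_iff_mem, RingHom.map_vecMul, hcomp, ← hAb, hv, Pi.zero_apply]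
    funext j
    have hj := hA _ hv' j
    rw [← Ideal.Quotient.eq_zero_iff_mem, hs] at hj
    exact hj
  -- a right inverse mod `𝔪`
  obtain ⟨g, hg⟩ := LinearMap.exists_leftInverse_of_injective _ hker
  have hC : Ab * (LinearMap.toMatrix' g)ᵀ = 1 := by
    have h := congrArg LinearMap.toMatrix' hg
    rw [LinearMap.toMatrix'_comp, LinearMap.toMatrix'_toLin', LinearMap.toMatrix'_id] at h
    simpa only [Matrix.transpose_mul, Matrix.transpose_transpose, Matrix.transpose_one] using
      congrArg Matrix.transpose h
  -- a lift `C₀` of it over `R`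
  obtain ⟨C₀, hC₀⟩ : ∃ C₀ : Matrix ν δ R,
      C₀.map (Ideal.Quotient.mk 𝔪) = (LinearMap.toMatrix' g)ᵀ := by
    refine ⟨(LinearMap.toMatrix' g)ᵀ.map s, ?_⟩
    ext i j
    simp only [Matrix.map_apply, hs]
  have hdet : Ideal.Quotient.mk 𝔪 (A * C₀).det = 1 := by
    have h := RingHom.map_det (Ideal.Quotient.mk 𝔪) (A * C₀)
    rw [RingHom.mapMatrix_apply, Matrix.map_mul, hC₀, ← hAb, hC, Matrix.det_one] at h
    exact h
  refine ⟨(A * C₀).det, C₀ * (A * C₀).adjugate, fun hmem ↦ ?_, ?_⟩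
  · rw [← Ideal.Quotient.eq_zero_iff_mem, hdet] at hmem
    exact one_ne_zero hmem
  · rw [← Matrix.mul_assoc, Matrix.mul_adjugate]

/-- **stub S14 — `stub_windowDeterminantTrick` (S/M; adjugate trick over a residue field).**  `R` a
commutative ring, `𝔪` a maximal ideal, `A : δ → X → R` (rows `j : δ`, finitely many; columns = exponents) and a
finite window `W`.  If `y ∈ R^δ` with `Σ_j y_j A j x ∈ 𝔪` for all `x ∈ W` forces `y ∈ 𝔪^δ` (rows independent
mod `𝔪`), then for every `m : X` there are `D ∉ 𝔪` and `k : X → R` supported on `W` with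
`D · A j m = Σ_{x ∈ W} k x · A j x` for every `j` (right inverse of `A mod 𝔪` on the window, lifted to `R`, times
the adjugate; port of the sibling's private `exists_mul_eq_smul_one` in `…IntegralOverconvergentIsCongruenceStubSupNormOfSturm.lean`
with `ℤ, p` replaced by `R, 𝔪` and `ZMod p` by `R ⧸ 𝔪`). [folklore] -/
theorem stub_windowDeterminantTrick {R : Type*} [CommRing R] (𝔪 : Ideal R) [𝔪.IsMaximal]
    {δ : Type*} [Fintype δ] [DecidableEq δ] {X : Type*} (W : Finset X) (A : δ → X → R)
    (hA : ∀ y : δ → R, (∀ x ∈ W, ∑ j, y j * A j x ∈ 𝔪) → ∀ j, y j ∈ 𝔪) (m : X) :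
    ∃ D : R, D ∉ 𝔪 ∧ ∃ k : X → R, (∀ x, x ∉ W → k x = 0) ∧ ∀ j, D * A j m = ∑ x ∈ W, k x * A j x := by
  classical
  -- the window matrix `A' = (A j x)_{j, x ∈ W}`
  obtain ⟨A', hA'⟩ : ∃ A' : Matrix δ W R, ∀ j x, A' j x = A j x :=
    ⟨Matrix.of fun j x ↦ A j x, fun _ _ ↦ rfl⟩
  -- its rows are linearly independent modulo `𝔪`
  have hindep : ∀ y : δ → R, (∀ i, (y ᵥ* A') i ∈ 𝔪) → ∀ j, y j ∈ 𝔪 := by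
    intro y hy
    refine hA y fun x hx ↦ ?_
    have h := hy ⟨x, hx⟩
    simpa only [Matrix.vecMul, dotProduct, hA'] using h
  -- the adjugate trick: `A' * C = D • 1` with `D ∉ 𝔪`
  obtain ⟨D, C, hD, hAC⟩ := winDet_exists_mul_eq_smul_one 𝔪 A' hindep
  -- the column `a = (A j m)_j` and the coefficient vector `k' = C a` on the window
  obtain ⟨a, ha⟩ : ∃ a : δ → R, ∀ j, a j = A j m := ⟨_, fun _ ↦ rfl⟩
  obtain ⟨k', hk'⟩ : ∃ k' : W → R, A' *ᵥ k' = D • a :=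
    ⟨C *ᵥ a, by rw [Matrix.mulVec_mulVec, hAC, Matrix.smul_mulVec, Matrix.one_mulVec]⟩
  refine ⟨D, hD, fun x ↦ if hx : x ∈ W then k' ⟨x, hx⟩ else 0, fun x hx ↦ dif_neg hx,
    fun j ↦ ?_⟩
  have hj := congr_fun hk' j
  simp only [Matrix.mulVec, dotProduct, hA', Pi.smul_apply, smul_eq_mul, ha] at hj
  rw [← hj, ← Finset.sum_coe_sort W]
  refine Finset.sum_congr rfl fun x _ ↦ ?_
  beta_reduce
  rw [dif_pos x.2, mul_comm]

end Summit.Langlands.Langlands.Theorems.HilbertIntegralOverconvergentIsCongruence
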